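import Literature.NumberTheory.EllipticCurves.DeligneSerreCompanionAuxiliaryPrimeDescentProofs
import Literature.NumberTheory.EllipticCurves.CuspFormLFunctionMeanSquareNonvanishingProofs
import Literature.NumberTheory.EllipticCurves.SurjectiveModPFrobeniusSupplyProofs
import Summits.BirchSwinnertonDyer.BirchSwinnertonDyer.Theorems.SignedLowerHalvesKobayashiLowerHalfLargeImageEdgeSeedCompanion
import HarnessLib

/-!
# Crux `KobayashiLowerHalfLargeImage` (item stmt-BirchSwinnertonDyer-19001), idea `edge-seed-rigidity`,
# stub S1 `stub_companionEdge` AT `p = 3` with the LITERAL level condition `M ∣ N_E`: the weight-`4`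
# companion newform `g ≡ f_E (mod 𝔭)`, `𝔭 ∣ 3`, of level DIVIDING `N_E`, with `L(g, 3) ≠ 0` — for every
# `E` good at `3` admitting ONE good prime `ℓ ≡ 2 (mod 3)` with `3 ∤ a_ℓ(E)`; no Deligne bound, no Katz lift

HONEST FRAMING (D-0152). Route K3 = `SignedLowerHalves` is a CLASS route; crux 3 is the Eisenstein half
of Kobayashi's signed main conjecture on the large-image corner of X7. NOTHING here proves the crux, the
route, or BSD. This is a HELPER of item 19001 (`--supports`), a sibling of
`…EdgeSeedCompanion.lean` (w2 g4: S1 at `p ≥ 5`), of w5/w7's weight-`(k₀+2)` companions at `p = 3`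
(`CongruentNewformMultiplierProofs`, `DeligneSerreCompanionAuxiliaryLevelProofs`: level `∣ N` when `N`
has a prime factor `≢ 1 (mod 3)`, level `∣ 2N` always), completing the `p = 3` case of S1 as follows.

The literal S1 asks for level `M ∣ N_E`. At `p = 3` the Deligne–Serre multiplier must have weight `2`;
on `Γ₀(N_E)` a weight-`2` form `≡ 1 (mod 3)` exists only if some prime factor of `N_E` is `≢ 1 (mod 3)`
(w5/w7), and the classical way around — Katz's lift of the Hasse invariant — is not in the tree. The
tree's `DeligneSerreCompanionAuxiliaryPrimeDescentProofs` (this seat) goes through an AUXILIARY good prime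
`ℓ ≡ 2 (mod 3)` instead (multiplier `E₂^{(ℓ)}/(1 − ℓ) ≡ 1 (mod 3)` at level `N_E ℓ`) and then DESCENDS:
running Deligne–Serre on the `ℓ`-stabilised form keeps `U_ℓ` in the Hecke family, and the companion can
be `ℓ`-new only in Ribet's level-raising class `a_ℓ(E)² ≡ (ℓ+1)² ≡ 0 (mod 3)`; so `3 ∤ a_ℓ(E)` forces
level `M ∣ N_E` (and the congruence at `ℓ` as well). The edge value `L(g, 3)` (weight `4`, `s = k − 1`,
the boundary of Hecke's half-plane) is non-zero UNCONDITIONALLY by Rankin's mean square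
(`IsNewform0.cuspFormLSeries_natCast_ne_zero`, `CuspFormLFunctionMeanSquareNonvanishingProofs`) — the
Deligne binder of `CuspFormLFunctionDeligneNonvanishingProofs` is not needed.

* `exists_companionEdge_three_descent_of_isNewformOf` — UNCONDITIONAL (given the newform `f` of
  `W`): `W` good at `3`, `ℓ ∤ N_W` prime, `ℓ ≡ 2 (mod 3)`, `3 ∤ a_ℓ(W)` ⟹ `M ∣ N_W` (so `3 ∤ M`), a newform
  `g ∈ S_4(Γ₀(M))`, `ι : ℚ̄₃ ≃ ℂ` with `‖ι⁻¹a_q(g) − a_q(W)‖₃ < 1` for EVERY prime `q ∤ N_W`, and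
  `L(g, 3) ≠ 0`.
* `stub_companionEdge_three_descent_of_exists_isNewformOf` — the ideator's S1 body VERBATIM
  (`Sketch.lean` definitions unfolded, as in `…EdgeSeedCompanion.lean`) at `p = 3`, GRANTED only the
  Modularity named fact `exists_isNewformOf` (the stub does not name `f`), under the extra per-curve
  hypothesis «∃ good prime `ℓ ≡ 2 (mod 3)` with `3 ∤ a_ℓ(W)`».

What is NOT proved (said, not hidden): the existence of such an `ℓ` for every `W` with `Surj W 3`
(true by Chebotarev in `ℚ(W[3])/ℚ`: the elements of `GL₂(𝔽₃)` of determinant `−1` and non-zero trace form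
a non-empty union of conjugacy classes — not in the tree; per curve it is a finite check, e.g. `ℓ = 2` when
`2 ∤ N_W` and `a_2(W)` is odd… precisely when `3 ∤ a_2(W)`); and nothing about the edge-seed ENGINE
S2–S5 (not in print / not typed).

References: Deligne–Serre 1974, Lemme 6.11 [DeligneSerreASENS1974]; Ribet, ICM 1983 [Ribet1984ICM];
Diamond–Shurman GTM 228, Prop. 5.6.2, Thm. 5.8.3 [DiamondShurman2005]; Rankin 1977, Thm. 4.5.2
[Rankin1977]; Breuil–Conrad–Diamond–Taylor 2001, Thm. A [BreuilConradDiamondTaylor2001]; crux workfiles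
`Cruxes/KobayashiLowerHalfLargeImage/{Ideas/edge-seed-rigidity.md, Lines/edge_seed_rigidity.md}`.
-/

set_option autoImplicit false
set_option linter.dupNamespace false

noncomputable section

open scoped MatrixGroups ModularForm

open CongruenceSubgroup UpperHalfPlane WeierstrassCurve
  Literature.NumberTheory.EllipticCurves Literature.NumberTheory.EllipticCurves.ModularForms
  Literature.NumberTheory.EllipticCurves.Rank1Residual

namespace Summit.BirchSwinnertonDyer.BirchSwinnertonDyer.Theorems.EdgeSeedRigidity

/-- **The weight-`4` edge companion at `p = 3`, of level dividing `N_W`, through an auxiliary prime**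
(unconditional given the newform `f` of `W`). Let `W/ℚ` be globally minimal with good reduction at `3`,
`f` its newform, and `ℓ ∤ N_W` a prime with `ℓ ≡ 2 (mod 3)` and `3 ∤ a_ℓ(W)`. Then there are `M ∣ N_W`
(so `3 ∤ M`), a newform `g ∈ S_4(Γ₀(M))` and `ι : ℚ̄₃ ≃ ℂ` with `‖ι⁻¹a_q(g) − a_q(W)‖₃ < 1` for every
prime `q ∤ N_W` (`a_q(g)` the `T_q`-eigenvalue), and `L(g, 3) ≠ 0`.  Deligne–Serre through the auxiliary
level `N_W ℓ` with Mazur's `E₂^{(ℓ)}/(1−ℓ)` and descent outside Ribet's class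
(`exists_isNewform0_dvd_level_congr_weight_add_two_three_of_auxPrime`), the modularity dictionary, and
Rankin's mean square for the edge value (`IsNewform0.cuspFormLSeries_natCast_ne_zero`).
[cite: DeligneSerreASENS1974, Lemme 6.11] [cite: Ribet1984ICM, Thm. 1 (necessity of the congruence)]
[cite: Rankin1977, Thm. 4.5.2 (iii)–(iv)] -/
theorem exists_companionEdge_three_descent_of_isNewformOf [Fact (3 : ℕ).Prime]
    (W : WeierstrassCurve ℚ) [W.IsElliptic] [W.IsGloballyMinimal] [NeZero (W.conductorNorm ℤ)]
    (hgood : W.HasGoodReductionAtPrime 3)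
    {f : CuspForm (Gamma0 (W.conductorNorm ℤ)) 2} (hf : IsNewformOf W f)
    {ℓ : ℕ} (hℓ : ℓ.Prime) (hℓN : ¬ ℓ ∣ W.conductorNorm ℤ) (hℓ3 : ℓ % 3 = 2)
    (haℓ : ¬ (3 : ℤ) ∣ W.frobeniusTrace ℓ) :
    ∃ (M : ℕ) (_ : NeZero M) (_ : M ∣ W.conductorNorm ℤ) (g : CuspForm (Gamma0 M) ((2 : ℤ) + 2))
      (ι : PadicAlgCl 3 ≃+* ℂ),
      IsNewform0 g ∧ ¬ 3 ∣ M ∧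
      (∀ q : ℕ, q.Prime → ¬ q ∣ W.conductorNorm ℤ →
        ‖ι.symm (heckeEigenvalue g q) - ((W.frobeniusTrace q : ℤ) : PadicAlgCl 3)‖ < 1) ∧
      cuspFormLSeries g (3 : ℂ) ≠ 0 := by
  obtain ⟨ι⟩ := PadicAlgCl.nonempty_ringEquiv_complex 3
  have h3N : ¬ 3 ∣ W.conductorNorm ℤ := not_dvd_level_of_isNewformOf hf hgood
  -- the dictionary `a_q(f) = a_q(W)` at good primes `q ∤ N`
  have hdict : ∀ q : ℕ, q.Prime → ¬ q ∣ W.conductorNorm ℤ →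
      (qExpansion 1 ⇑f).coeff q = ((W.frobeniusTrace q : ℤ) : ℂ) := by
    intro q hq hqN
    haveI : Fact q.Prime := ⟨hq⟩
    rw [← WeierstrassCurve.LFunction_apply_prime_eq_frobeniusTrace W q
      (hasGoodReductionAtPrime_of_not_dvd_conductorNorm W hqN)]
    exact hf.2 q
  -- `a_ℓ(f)` is a `3`-adic unit
  have hunit : ‖ι.symm ((qExpansion 1 ⇑f).coeff ℓ)‖ = 1 := by
    rw [hdict ℓ hℓ hℓN, map_intCast]
    exact DeligneSerreLift.norm_intCast_eq_one_of_not_dvd haℓ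
  -- Deligne–Serre through `N ℓ` and descent
  obtain ⟨M, hM, hMN, g, hg, hcong⟩ :=
    exists_isNewform0_dvd_level_congr_weight_add_two_three_of_auxPrime ι hℓ hℓN hℓ3 le_rfl hf.1 hunit
  refine ⟨M, hM, hMN, g, ι, hg, fun h ↦ h3N (h.trans hMN), fun q hq hqN ↦ ?_, ?_⟩
  · have h := hcong q hq hqN
    rw [hdict q hq hqN, map_intCast] at h
    rw [IsNewform0.heckeEigenvalue_eq_coeff_holds hg hq]
    exact h
  · -- the edge value `L(g, 3)`, `2 · 3 > 4 + 1` (Rankin's half-plane)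
    have h := IsNewform0.cuspFormLSeries_natCast_ne_zero hg (m := 3) (by norm_num)
    simpa using h

/-- **`stub_companionEdge` of the line card `Lines/edge_seed_rigidity.md` AT `p = 3`, level `M ∣ N_W`,
granted the Modularity Theorem and one auxiliary prime.** The ideator's stub body (`Sketch.lean` of item
19001; `IsCompanionForm` / `IsCongruentFormModP` UNFOLDED as in
`stub_companionEdge_of_five_le_of_exists_isNewformOf`) with `p = 3`, under the per-curve hypothesis that
SOME good prime `ℓ ≡ 2 (mod 3)` has `3 ∤ a_ℓ(W)` (for `Surj W 3` such `ℓ` exist by Chebotarev — not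
claimed). The weight is `p + 1 = 4`, the level divides `N_W` LITERALLY, the congruence holds at every prime
`∤ 3·M·N_W`, and `L(g, 3) ≠ 0` with NO Deligne bound. Inputs beyond proved theorems: only the named fact
`exists_isNewformOf` (Breuil–Conrad–Diamond–Taylor 2001, Thm. A). `ClassX7 W 3` is used through good
reduction at `3` only; `a_3 = 0` and `Surj W 3` are idle (S1 does not need them). CONDITIONAL on `hmod`;
calibration of S1 only — the line's engine S2 is not in print.
[cite: BreuilConradDiamondTaylor2001, Thm. A] [cite: DeligneSerreASENS1974, Lemme 6.11]
[cite: Ribet1984ICM, Thm. 1 (necessity of the congruence)] [cite: Rankin1977, Thm. 4.5.2 (iii)–(iv)] -/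
theorem stub_companionEdge_three_descent_of_exists_isNewformOf (hmod : exists_isNewformOf) :
    ∀ (W : WeierstrassCurve ℚ) [W.IsElliptic] [W.IsGloballyMinimal] (p : ℕ) [Fact p.Prime],
      p = 3 → ClassX7 W p → W.frobeniusTrace p = 0 → Surj W p →
      (∃ ℓ : ℕ, ℓ.Prime ∧ ¬ ℓ ∣ W.conductorNorm ℤ ∧ ℓ % 3 = 2 ∧ ¬ (3 : ℤ) ∣ W.frobeniusTrace ℓ) →
      ∃ (M : ℕ) (_ : NeZero M) (g : CuspForm (Gamma0 M) ((p : ℤ) + 1)),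
        (IsNewform0 g ∧ ¬ (p ∣ M) ∧ M ∣ W.conductorNorm ℤ ∧
          ∃ (ι : PadicAlgCl p →+* ℂ) (b : ℕ → PadicAlgCl p),
            ∀ ℓ : ℕ, ℓ.Prime → ¬ (ℓ ∣ p * M * W.conductorNorm ℤ) →
              ι (b ℓ) = heckeEigenvalue g ℓ ∧
                ‖b ℓ - (W.frobeniusTrace ℓ : PadicAlgCl p)‖ < 1) ∧
        cuspFormLSeries g (p : ℂ) ≠ 0 := by
  intro W _ _ p _ hp3 hX _ _ haux
  subst hp3
  haveI : NeZero (W.conductorNorm ℤ) := ⟨(W.conductorNorm_pos_holds : 0 < W.conductorNorm ℤ).ne'⟩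
  obtain ⟨ℓ, hℓ, hℓN, hℓ3, haℓ⟩ := haux
  obtain ⟨f, hf⟩ := hmod W
  obtain ⟨M, hM, hMN, g, ι, hg, h3M, hcong, hL⟩ :=
    exists_companionEdge_three_descent_of_isNewformOf W hX.1.1 hf hℓ hℓN hℓ3 haℓ
  have hk : ((3 : ℕ) : ℤ) + 1 = (2 : ℤ) + 2 := by norm_num
  rw [hk]
  refine ⟨M, hM, g, ⟨hg, h3M, hMN, (ι : PadicAlgCl 3 →+* ℂ), fun q ↦ ι.symm (heckeEigenvalue g q),
    fun q hq hqpMN ↦ ⟨ι.apply_symm_apply _, ?_⟩⟩, by simpa using hL⟩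
  exact hcong q hq fun h ↦ hqpMN (h.mul_left (3 * M))

/-- **`stub_companionEdge` AT `p = 3` ON THE WHOLE POPULATION OF THE CRUX — level `M ∣ N_W` literally,
granted the Modularity Theorem ONLY.** The crux's own hypothesis `Surj W 3` (`ρ̄_{E,3}` onto) SUPPLIES
the auxiliary prime of `stub_companionEdge_three_descent_of_exists_isNewformOf`: by the Chebotarev
density theorem for `ℚ(E[3])` — a THEOREM of the tree (`chebotarev_geomTorsion_holds`) — read through
Serre's (238) and DDT 2.8 (a) (`exists_goodPrime_mod_three_eq_two_not_dvd_frobeniusTrace_of_surj`,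
`SurjectiveModPFrobeniusSupplyProofs`), there is a good prime `ℓ ∤ N_W`, `ℓ ≡ 2 (mod 3)`, with
`3 ∤ a_ℓ(W)` (the class `(tr, det) = (1, −1)` of `GL₂(𝔽₃)`). Hence, for EVERY pair `(W, 3)` of crux 3
(`ClassX7 W 3`, `a₃ = 0`, `Surj W 3`): a weight-`4` newform `g` of level `M ∣ N_W`, `3 ∤ M`, congruent to
`f_W` modulo `𝔪` at every prime `∤ 3·M·N_W`, with `L(g, 3) ≠ 0` — the ideator's S1 body VERBATIM at
`p = 3`, no residue, no Deligne bound, no Katz lift. Together with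
`stub_companionEdge_of_five_le_of_exists_isNewformOf` (w2 g4): **S1 of line `edge_seed_rigidity` holds
at EVERY odd prime on the crux's population, modulo `exists_isNewformOf` only.** CONDITIONAL on `hmod`;
calibration of S1 only — the engine S2 is not in print; the crux is NOT proved.
[cite: BreuilConradDiamondTaylor2001, Thm. A] [cite: TateGCFT1967, §2.4 (Tchebotarev density theorem)]
[cite: DeligneSerreASENS1974, Lemme 6.11] [cite: Ribet1984ICM, Thm. 1 (necessity of the congruence)]
[cite: Rankin1977, Thm. 4.5.2 (iii)–(iv)] -/
theorem stub_companionEdge_three_descent_of_exists_isNewformOf_of_surj (hmod : exists_isNewformOf) :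
    ∀ (W : WeierstrassCurve ℚ) [W.IsElliptic] [W.IsGloballyMinimal] (p : ℕ) [Fact p.Prime],
      p = 3 → ClassX7 W p → W.frobeniusTrace p = 0 → Surj W p →
      ∃ (M : ℕ) (_ : NeZero M) (g : CuspForm (Gamma0 M) ((p : ℤ) + 1)),
        (IsNewform0 g ∧ ¬ (p ∣ M) ∧ M ∣ W.conductorNorm ℤ ∧
          ∃ (ι : PadicAlgCl p →+* ℂ) (b : ℕ → PadicAlgCl p),
            ∀ ℓ : ℕ, ℓ.Prime → ¬ (ℓ ∣ p * M * W.conductorNorm ℤ) →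
              ι (b ℓ) = heckeEigenvalue g ℓ ∧
                ‖b ℓ - (W.frobeniusTrace ℓ : PadicAlgCl p)‖ < 1) ∧
        cuspFormLSeries g (p : ℂ) ≠ 0 := by
  intro W _ _ p _ hp3 hX hap hs
  subst hp3
  -- the auxiliary prime from `Surj W 3` (Chebotarev), outside the prime divisors of `N_W`
  have hN0 : W.conductorNorm ℤ ≠ 0 := (W.conductorNorm_pos_holds : 0 < W.conductorNorm ℤ).ne'
  have hS : {q : ℕ | q ∣ W.conductorNorm ℤ}.Finite :=
    (Set.finite_le_nat (W.conductorNorm ℤ)).subset fun q hq ↦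
      Nat.le_of_dvd (Nat.pos_of_ne_zero hN0) hq
  obtain ⟨ℓ, hℓ, hℓN, -, -, hℓ3, haℓ⟩ :=
    exists_goodPrime_mod_three_eq_two_not_dvd_frobeniusTrace_of_surj W hs _ hS
  exact stub_companionEdge_three_descent_of_exists_isNewformOf hmod W 3 rfl hX hap hs
    ⟨ℓ, hℓ, hℓN, hℓ3, haℓ⟩

end Summit.BirchSwinnertonDyer.BirchSwinnertonDyer.Theorems.EdgeSeedRigidity

end
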